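import Summits.NavierStokesRegularity.NavierStokesRegularity.Theorems.ExtremiserTransienceTwoThirdsDefs
import HarnessLib

/-!
# Route `ExtremiserTransience`, crux `NearExtremalTransiencePerFlow` (stmt-NavierStokesRegularity-26567),
# LINE g10-1 «two_thirds» (ns-idea-10), stub S1a′ — BRICK 2, lemma P3f: `L²` SIZE OF A LAYER-SUPPORTED OFFSET FROM A POINTWISE MAJORANT

`--supports stmt-NavierStokesRegularity-26567` (helper; prover seat ns-net-p2 g13).  Pure measure bookkeeping used for the two offsets of a piece
(`…TwoThirdsPieceBounds`, p731375): a field `e` vanishing off a set `L ⊆ S` of finite volume and bounded on `L` by an affine combination of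
nonnegative functions has

* `integral_sq_le_of_affine_three` — `‖e‖ ≤ α + β f + γ g` on `L` ⟹ `∫‖e‖² ≤ 3(α²·vol S + β² ∫_S f² + γ² ∫_S g²)`;
* `integral_sq_le_of_affine_six` — the same with five functions and the factor `6`.
(Cauchy–Schwarz on `ℝ³ᵒʳ⁶`, then integrate the indicator-supported majorant.)  With `α ~ ρ⁻¹³`, `vol S ~ ρ²⁴`, `β, γ ~ ρ⁻⁷` and the linear-growth /
Calderón–Zygmund budgets `∫_S‖w‖² ≲ ρ⁸`, `∫‖Dψ‖² ≲ ρ⁸` every term is `O(ρ⁻²)`.  HONEST FRAMING: nothing about Navier–Stokes is proved;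
no summit is proved by a line. [folklore]
-/

noncomputable section

open scoped Topology InnerProductSpace RealInnerProductSpace ENNReal NNReal ContDiff
open MeasureTheory Filter Set Metric
open Literature.Analysis.FluidPDE
open Summit.NavierStokesRegularity.NavierStokesRegularity.Theorems.DepletionLadder.KStar.HalfSpace

namespace Summit.NavierStokesRegularity.NavierStokesRegularity.Theorems.NearExtremalTransiencePerFlow.TwoThirds

-- the summit's namespace repeats the problem name by convention (D-0017)
set_option linter.dupNamespace false

section L2

variable {e : E3 → E3} {L S : Set E3}

/-- **Three-term version.**  `‖e‖ ≤ α + β f + γ g` on `L ⊆ S`, `e = 0` off `L` ⟹ `∫‖e‖² ≤ 3(α² vol S + β²∫_S f² + γ²∫_S g²)`. [folklore] -/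
theorem integral_sq_le_of_affine_three (hLS : L ⊆ S) (hS : MeasurableSet S) (hSvol : volume S ≠ ⊤)
    (he0 : ∀ x, x ∉ L → e x = 0) (hie : Integrable fun x => ‖e x‖ ^ 2)
    {α β γ : ℝ} {f g : E3 → ℝ}
    (hf : IntegrableOn (fun x => f x ^ 2) S) (hg : IntegrableOn (fun x => g x ^ 2) S)
    (hle : ∀ x ∈ L, ‖e x‖ ≤ α + β * f x + γ * g x) :
    ∫ x, ‖e x‖ ^ 2 ≤ 3 * (α ^ 2 * (volume S).toReal + β ^ 2 * (∫ x in S, f x ^ 2) + γ ^ 2 * (∫ x in S, g x ^ 2)) := by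
  -- pointwise majorant supported in `S`
  have hpt : ∀ x, ‖e x‖ ^ 2 ≤ S.indicator (fun _ => 3 * α ^ 2) x + S.indicator (fun y => 3 * (β ^ 2 * f y ^ 2)) x +
      S.indicator (fun y => 3 * (γ ^ 2 * g y ^ 2)) x := by
    intro x
    by_cases hx : x ∈ L
    · have hxS : x ∈ S := hLS hx
      rw [indicator_of_mem hxS, indicator_of_mem hxS, indicator_of_mem hxS]
      have h := hle x hx
      have h2 : ‖e x‖ ^ 2 ≤ (α + β * f x + γ * g x) ^ 2 := pow_le_pow_left₀ (norm_nonneg _) h 2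
      nlinarith only [h2, sq_nonneg (α - β * f x), sq_nonneg (α - γ * g x), sq_nonneg (β * f x - γ * g x)]
    · rw [he0 x hx, norm_zero, zero_pow two_ne_zero]
      have i1 : 0 ≤ S.indicator (fun _ => 3 * α ^ 2) x := indicator_nonneg (fun y _ => by positivity) x
      have i2 : 0 ≤ S.indicator (fun y => 3 * (β ^ 2 * f y ^ 2)) x := indicator_nonneg (fun y _ => by positivity) x
      have i3 : 0 ≤ S.indicator (fun y => 3 * (γ ^ 2 * g y ^ 2)) x := indicator_nonneg (fun y _ => by positivity) x
      linarith only [i1, i2, i3]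
  haveI : IsFiniteMeasure (volume.restrict S) := ⟨by rw [Measure.restrict_apply_univ]; exact hSvol.lt_top⟩
  have hi1 : Integrable (S.indicator fun _ : E3 => 3 * α ^ 2) :=
    (integrable_indicator_iff hS).2 (integrable_const _)
  have hi2 : Integrable (S.indicator fun y => 3 * (β ^ 2 * f y ^ 2)) :=
    (integrable_indicator_iff hS).2 ((hf.const_mul _).const_mul _)
  have hi3 : Integrable (S.indicator fun y => 3 * (γ ^ 2 * g y ^ 2)) :=
    (integrable_indicator_iff hS).2 ((hg.const_mul _).const_mul _)
  have hmono : ∫ x, ‖e x‖ ^ 2 ≤ ∫ x, (S.indicator (fun _ => 3 * α ^ 2) x + S.indicator (fun y => 3 * (β ^ 2 * f y ^ 2)) x +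
      S.indicator (fun y => 3 * (γ ^ 2 * g y ^ 2)) x) := integral_mono hie ((hi1.add hi2).add hi3) hpt
  have hsplit : ∫ x, (S.indicator (fun _ => 3 * α ^ 2) x + S.indicator (fun y => 3 * (β ^ 2 * f y ^ 2)) x +
      S.indicator (fun y => 3 * (γ ^ 2 * g y ^ 2)) x) = (∫ x, S.indicator (fun _ => 3 * α ^ 2) x) +
      (∫ x, S.indicator (fun y => 3 * (β ^ 2 * f y ^ 2)) x) + ∫ x, S.indicator (fun y => 3 * (γ ^ 2 * g y ^ 2)) x := by
    rw [integral_add (f := fun x => S.indicator (fun _ => 3 * α ^ 2) x + S.indicator (fun y => 3 * (β ^ 2 * f y ^ 2)) x)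
      (g := fun x => S.indicator (fun y => 3 * (γ ^ 2 * g y ^ 2)) x) (hi1.add hi2) hi3,
      integral_add (f := fun x => S.indicator (fun _ => 3 * α ^ 2) x) (g := fun x => S.indicator (fun y => 3 * (β ^ 2 * f y ^ 2)) x) hi1 hi2]
  have e1 : ∫ x, S.indicator (fun _ : E3 => 3 * α ^ 2) x = 3 * α ^ 2 * (volume S).toReal := by
    rw [integral_indicator hS, setIntegral_const, smul_eq_mul, Measure.real, mul_comm]
  have e2 : ∫ x, S.indicator (fun y => 3 * (β ^ 2 * f y ^ 2)) x = 3 * (β ^ 2 * (∫ x in S, f x ^ 2)) := by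
    rw [integral_indicator hS, integral_const_mul, integral_const_mul]
  have e3 : ∫ x, S.indicator (fun y => 3 * (γ ^ 2 * g y ^ 2)) x = 3 * (γ ^ 2 * (∫ x in S, g x ^ 2)) := by
    rw [integral_indicator hS, integral_const_mul, integral_const_mul]
  linarith only [hmono, hsplit, e1, e2, e3]

/-- **Six-term version.**  `‖e‖ ≤ α + Σ_{k≤5} βₖ fₖ` on `L ⊆ S`, `e = 0` off `L` ⟹ `∫‖e‖² ≤ 6(α² vol S + Σ βₖ² ∫_S fₖ²)`. [folklore] -/
theorem integral_sq_le_of_affine_six (hLS : L ⊆ S) (hS : MeasurableSet S) (hSvol : volume S ≠ ⊤)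
    (he0 : ∀ x, x ∉ L → e x = 0) (hie : Integrable fun x => ‖e x‖ ^ 2)
    {α b₁ b₂ b₃ b₄ b₅ : ℝ} {f₁ f₂ f₃ f₄ f₅ : E3 → ℝ}
    (hf₁ : IntegrableOn (fun x => f₁ x ^ 2) S) (hf₂ : IntegrableOn (fun x => f₂ x ^ 2) S) (hf₃ : IntegrableOn (fun x => f₃ x ^ 2) S)
    (hf₄ : IntegrableOn (fun x => f₄ x ^ 2) S) (hf₅ : IntegrableOn (fun x => f₅ x ^ 2) S)
    (hle : ∀ x ∈ L, ‖e x‖ ≤ α + b₁ * f₁ x + b₂ * f₂ x + b₃ * f₃ x + b₄ * f₄ x + b₅ * f₅ x) :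
    ∫ x, ‖e x‖ ^ 2 ≤ 6 * (α ^ 2 * (volume S).toReal + b₁ ^ 2 * (∫ x in S, f₁ x ^ 2) + b₂ ^ 2 * (∫ x in S, f₂ x ^ 2) +
      b₃ ^ 2 * (∫ x in S, f₃ x ^ 2) + b₄ ^ 2 * (∫ x in S, f₄ x ^ 2) + b₅ ^ 2 * (∫ x in S, f₅ x ^ 2)) := by
  set F : E3 → ℝ := fun y => 6 * α ^ 2 + 6 * (b₁ ^ 2 * f₁ y ^ 2) + 6 * (b₂ ^ 2 * f₂ y ^ 2) + 6 * (b₃ ^ 2 * f₃ y ^ 2) +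
    6 * (b₄ ^ 2 * f₄ y ^ 2) + 6 * (b₅ ^ 2 * f₅ y ^ 2) with hF
  have hF0 : ∀ y, 0 ≤ F y := fun y => by rw [hF]; positivity
  have hpt : ∀ x, ‖e x‖ ^ 2 ≤ S.indicator F x := by
    intro x
    by_cases hx : x ∈ L
    · have hxS : x ∈ S := hLS hx
      rw [indicator_of_mem hxS, hF]
      have h := hle x hx
      have h2 : ‖e x‖ ^ 2 ≤ (α + b₁ * f₁ x + b₂ * f₂ x + b₃ * f₃ x + b₄ * f₄ x + b₅ * f₅ x) ^ 2 :=
        pow_le_pow_left₀ (norm_nonneg _) h 2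
      nlinarith only [h2, sq_nonneg (α - b₁ * f₁ x), sq_nonneg (α - b₂ * f₂ x), sq_nonneg (α - b₃ * f₃ x), sq_nonneg (α - b₄ * f₄ x),
        sq_nonneg (α - b₅ * f₅ x), sq_nonneg (b₁ * f₁ x - b₂ * f₂ x), sq_nonneg (b₁ * f₁ x - b₃ * f₃ x),
        sq_nonneg (b₁ * f₁ x - b₄ * f₄ x), sq_nonneg (b₁ * f₁ x - b₅ * f₅ x), sq_nonneg (b₂ * f₂ x - b₃ * f₃ x),
        sq_nonneg (b₂ * f₂ x - b₄ * f₄ x), sq_nonneg (b₂ * f₂ x - b₅ * f₅ x), sq_nonneg (b₃ * f₃ x - b₄ * f₄ x),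
        sq_nonneg (b₃ * f₃ x - b₅ * f₅ x), sq_nonneg (b₄ * f₄ x - b₅ * f₅ x)]
    · rw [he0 x hx, norm_zero, zero_pow two_ne_zero]
      exact indicator_nonneg (fun y _ => hF0 y) x
  haveI : IsFiniteMeasure (volume.restrict S) := ⟨by rw [Measure.restrict_apply_univ]; exact hSvol.lt_top⟩
  have hFi : IntegrableOn F S := by
    rw [hF]
    exact (((((integrable_const _).add ((hf₁.const_mul _).const_mul _)).add ((hf₂.const_mul _).const_mul _)).add
      ((hf₃.const_mul _).const_mul _)).add ((hf₄.const_mul _).const_mul _)).add ((hf₅.const_mul _).const_mul _)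
  have hi : Integrable (S.indicator F) := (integrable_indicator_iff hS).2 hFi
  have hmono := integral_mono hie hi hpt
  rw [integral_indicator hS] at hmono
  have hval : ∫ x in S, F x = 6 * α ^ 2 * (volume S).toReal + 6 * (b₁ ^ 2 * (∫ x in S, f₁ x ^ 2)) + 6 * (b₂ ^ 2 * (∫ x in S, f₂ x ^ 2)) +
      6 * (b₃ ^ 2 * (∫ x in S, f₃ x ^ 2)) + 6 * (b₄ ^ 2 * (∫ x in S, f₄ x ^ 2)) + 6 * (b₅ ^ 2 * (∫ x in S, f₅ x ^ 2)) := by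
    have i0 : Integrable (fun _ : E3 => 6 * α ^ 2) (volume.restrict S) := integrable_const _
    have i1 : Integrable (fun y => 6 * (b₁ ^ 2 * f₁ y ^ 2)) (volume.restrict S) := (hf₁.const_mul _).const_mul _
    have i2 : Integrable (fun y => 6 * (b₂ ^ 2 * f₂ y ^ 2)) (volume.restrict S) := (hf₂.const_mul _).const_mul _
    have i3 : Integrable (fun y => 6 * (b₃ ^ 2 * f₃ y ^ 2)) (volume.restrict S) := (hf₃.const_mul _).const_mul _
    have i4 : Integrable (fun y => 6 * (b₄ ^ 2 * f₄ y ^ 2)) (volume.restrict S) := (hf₄.const_mul _).const_mul _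
    have i5 : Integrable (fun y => 6 * (b₅ ^ 2 * f₅ y ^ 2)) (volume.restrict S) := (hf₅.const_mul _).const_mul _
    have s1 : Integrable (fun y => 6 * α ^ 2 + 6 * (b₁ ^ 2 * f₁ y ^ 2)) (volume.restrict S) := i0.add i1
    have s2 : Integrable (fun y => 6 * α ^ 2 + 6 * (b₁ ^ 2 * f₁ y ^ 2) + 6 * (b₂ ^ 2 * f₂ y ^ 2)) (volume.restrict S) := s1.add i2
    have s3 : Integrable (fun y => 6 * α ^ 2 + 6 * (b₁ ^ 2 * f₁ y ^ 2) + 6 * (b₂ ^ 2 * f₂ y ^ 2) + 6 * (b₃ ^ 2 * f₃ y ^ 2))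
      (volume.restrict S) := s2.add i3
    have s4 : Integrable (fun y => 6 * α ^ 2 + 6 * (b₁ ^ 2 * f₁ y ^ 2) + 6 * (b₂ ^ 2 * f₂ y ^ 2) + 6 * (b₃ ^ 2 * f₃ y ^ 2) +
      6 * (b₄ ^ 2 * f₄ y ^ 2)) (volume.restrict S) := s3.add i4
    have e5 : ∫ x in S, F x = (∫ x in S, (6 * α ^ 2 + 6 * (b₁ ^ 2 * f₁ x ^ 2) + 6 * (b₂ ^ 2 * f₂ x ^ 2) + 6 * (b₃ ^ 2 * f₃ x ^ 2) +
        6 * (b₄ ^ 2 * f₄ x ^ 2))) + ∫ x in S, 6 * (b₅ ^ 2 * f₅ x ^ 2) := by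
      rw [hF]; exact integral_add s4 i5
    have e4 : ∫ x in S, (6 * α ^ 2 + 6 * (b₁ ^ 2 * f₁ x ^ 2) + 6 * (b₂ ^ 2 * f₂ x ^ 2) + 6 * (b₃ ^ 2 * f₃ x ^ 2) + 6 * (b₄ ^ 2 * f₄ x ^ 2)) =
        (∫ x in S, (6 * α ^ 2 + 6 * (b₁ ^ 2 * f₁ x ^ 2) + 6 * (b₂ ^ 2 * f₂ x ^ 2) + 6 * (b₃ ^ 2 * f₃ x ^ 2))) +
          ∫ x in S, 6 * (b₄ ^ 2 * f₄ x ^ 2) := integral_add s3 i4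
    have e3 : ∫ x in S, (6 * α ^ 2 + 6 * (b₁ ^ 2 * f₁ x ^ 2) + 6 * (b₂ ^ 2 * f₂ x ^ 2) + 6 * (b₃ ^ 2 * f₃ x ^ 2)) =
        (∫ x in S, (6 * α ^ 2 + 6 * (b₁ ^ 2 * f₁ x ^ 2) + 6 * (b₂ ^ 2 * f₂ x ^ 2))) + ∫ x in S, 6 * (b₃ ^ 2 * f₃ x ^ 2) :=
      integral_add s2 i3
    have e2 : ∫ x in S, (6 * α ^ 2 + 6 * (b₁ ^ 2 * f₁ x ^ 2) + 6 * (b₂ ^ 2 * f₂ x ^ 2)) =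
        (∫ x in S, (6 * α ^ 2 + 6 * (b₁ ^ 2 * f₁ x ^ 2))) + ∫ x in S, 6 * (b₂ ^ 2 * f₂ x ^ 2) := integral_add s1 i2
    have e1 : ∫ x in S, (6 * α ^ 2 + 6 * (b₁ ^ 2 * f₁ x ^ 2)) = (∫ x in S, (6 * α ^ 2 : ℝ)) + ∫ x in S, 6 * (b₁ ^ 2 * f₁ x ^ 2) :=
      integral_add i0 i1
    have c0 : ∫ x in S, (6 * α ^ 2 : ℝ) = 6 * α ^ 2 * (volume S).toReal := by
      rw [setIntegral_const, smul_eq_mul, Measure.real, mul_comm]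
    have c1 : ∫ x in S, 6 * (b₁ ^ 2 * f₁ x ^ 2) = 6 * (b₁ ^ 2 * (∫ x in S, f₁ x ^ 2)) := by rw [integral_const_mul, integral_const_mul]
    have c2 : ∫ x in S, 6 * (b₂ ^ 2 * f₂ x ^ 2) = 6 * (b₂ ^ 2 * (∫ x in S, f₂ x ^ 2)) := by rw [integral_const_mul, integral_const_mul]
    have c3 : ∫ x in S, 6 * (b₃ ^ 2 * f₃ x ^ 2) = 6 * (b₃ ^ 2 * (∫ x in S, f₃ x ^ 2)) := by rw [integral_const_mul, integral_const_mul]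
    have c4 : ∫ x in S, 6 * (b₄ ^ 2 * f₄ x ^ 2) = 6 * (b₄ ^ 2 * (∫ x in S, f₄ x ^ 2)) := by rw [integral_const_mul, integral_const_mul]
    have c5 : ∫ x in S, 6 * (b₅ ^ 2 * f₅ x ^ 2) = 6 * (b₅ ^ 2 * (∫ x in S, f₅ x ^ 2)) := by rw [integral_const_mul, integral_const_mul]
    linarith only [e5, e4, e3, e2, e1, c0, c1, c2, c3, c4, c5]
  linarith only [hmono, hval]

end L2

end Summit.NavierStokesRegularity.NavierStokesRegularity.Theorems.NearExtremalTransiencePerFlow.TwoThirds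

end
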